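import Summits.NavierStokesRegularity.NavierStokesRegularity.Theorems.TypeICertificateLadderTargetAmplitudeRungLambSplit
import Summits.NavierStokesRegularity.NavierStokesRegularity.Theorems.TypeICertificateLadderTargetDepletionAlignmentIdentity
import Summits.NavierStokesRegularity.NavierStokesRegularity.Theorems.TypeICertificateLadderTargetFlowwiseDepletionSlab
import Summits.NavierStokesRegularity.NavierStokesRegularity.Theorems.ExtremiserTransienceNearExtremalTransienceThetaOne
import HarnessLib

/-!
# Crux `Target` = `TypeICertificateLadder.NoTypeIBlowup` (stmt-NavierStokesRegularity-1217), line
# `depletion-ladder`: THE NORMAL-VELOCITY RUNG — only the velocity component NORMAL to the vorticity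
# produces enstrophy, and it must reach the self-similar rate `√(ν/(T−t))` (constant ONE) at a singular time

`--supports stmt-NavierStokesRegularity-1217` (helper). Author: STA lineage `ns-sta-19551-p1` (g11).

In the Lamb pairing `J = ∫⟪ω, Dv ω⟫ = ∫⟪v, ω × curl ω⟫` (g6, `integral_stretching_eq_integral_inner_cross`) the
triple product is `⟪curl ω, v × ω⟫`, so ONLY THE COMPONENT OF `v` NORMAL TO `ω` enters:
`|J| ≤ ∫ |curl ω|·|v × ω| ≤ M_⊥ · ‖ω‖₂ · ‖curl ω‖₂` whenever `|v × ω| ≤ M_⊥|ω|` pointwise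
(`M_⊥ = sup_x |v − (v·ω̂)ω̂| = sup |v| sin∠(v, ω)`). In the split bound of `…StrainCubeLambSplit*` this
component is PURE SLACK of the Lamb share (the strain-cube share still sees the full `|v| ≤ M`). Fed into
the log-mean stretching law (p582058) through the abstract amplitude rung (p586364,
`hasSmoothExtensionPast_of_logIntegral_amplitude_of_depletion` with `κ = 1`):

* `abs_inner_cross_le_norm_mul_norm_cross`, `abs_integral_stretching_le_normalAmplitude` — the kinematic bound on
  the class of the line's `StretchingDepletion` (`C²`, divergence free, bounded, `ω, ∇ω ∈ L²`, integrable
  stretching): `|∫⟪ω, Dv ω⟫| ≤ M_⊥ ‖ω‖₂ ‖curl ω‖₂`.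
* `normalAmplitude_along_flow` — along a classical Leray–Hopf rapidly-decaying-datum flow, at every
  `t ∈ [0,T)`: `|J(t)| ≤ M_⊥(t)·‖ω(t)‖₂·‖∇ω(t)‖₂` for every `M_⊥(t)` with `|u(t,x) × ω(t,x)| ≤ M_⊥(t)|ω(t,x)|`.
* `hasSmoothExtensionPast_of_logIntegral_normalAmplitude` — **THE NORMAL-VELOCITY RUNG (log-mean form)**:
  `∫_{t₁}^t M_⊥² ≤ ν(A log((T−t₁)/(T−t)) + B)` with `A < 1` ⇒ smooth extension past `T`; NO hypothesis on the
  full speed (Type I or not).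
* `hasSmoothExtensionPast_of_normalVelocityRate` — sup form: eventually
  `√(T−t)·|u(t,x) × ω(t,x)| ≤ C_⊥ √ν |ω(t,x)|` with `C_⊥ < 1` ⇒ extension.
* `frequently_normalVelocity_gt_of_not_hasSmoothExtensionPast` — PORTRAIT: at a singular time, for every
  `C_⊥ < 1`, the normal velocity exceeds `C_⊥√(ν/(T−t))·` somewhere, at times accumulating at `T` — a flow
  that Beltramises (`v ∥ ω`) fast enough in its high-vorticity region cannot blow up, WHATEVER ITS SPEED.

Compare Leray's rate for the full speed (`sup|u(t)| ≥ c√ν/√(T−t)`, `leray_blowup_rate`) and the ladder's rung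
`C ≤ 2.5` for the full rate: the normal component alone must reach rate `1` in log-quadratic mean. Nearest prior
art: Berselli–Córdoba, C. R. Acad. Sci. 347 (2009) (velocity ⟂ vorticity, Lipschitz in the shift, on `T³` ⇒
regular; tree `TorusNSBerselliCordobaCriterion`); Farhat–Grujić, J. Nonlinear Sci. 29 (2019) = arXiv:1804.08238
(local near-Beltrami depletion, `sup sin∠(u,ω)·‖∇u‖^{1/2}_{L²(high set)} ≤ c`; tree `TorusNSNearBeltramiCriterion`).
Delta: whole-space Type-I currency, the normal SPEED (not the angle) against the self-similar rate, sharp constant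
`1`, log-mean in time. WHAT THIS IS NOT: a conditional criterion; nothing here excludes any blow-up. [folklore]
-/

noncomputable section

open Set Filter Topology MeasureTheory
open scoped RealInnerProductSpace ENNReal NNReal ContDiff
open Literature.Analysis.FluidPDE

namespace Summit.NavierStokesRegularity.NavierStokesRegularity.Theorems.DepletionLadder

-- the problem directory repeats the summit name (`NavierStokesRegularity/NavierStokesRegularity`)
set_option linter.dupNamespace false

open Summit.NavierStokesRegularity.NavierStokesRegularity.Theorems.RungReynoldsOne

/-! ## Kinematics: only the normal velocity pairs with `ω × curl ω` -/

/-- `|⟪v, ω × c⟫| ≤ ‖c‖ · ‖v × ω‖` (the triple product is `⟪c, v × ω⟫`). [folklore] -/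
theorem abs_inner_cross_le_norm_mul_norm_cross (v w c : EuclideanSpace ℝ (Fin 3)) :
    |⟪v, cross w c⟫| ≤ ‖c‖ * ‖cross v w‖ := by
  rw [← StrainCube.inner_cross_cyclic]; exact abs_real_inner_le_norm _ _

variable {v : EuclideanSpace ℝ (Fin 3) → EuclideanSpace ℝ (Fin 3)}

/-- **The normal-velocity bound** on the class of `StretchingDepletion`: for `v ∈ C²` divergence free with
`|v| ≤ M`, `ω = curl v ∈ L²`, `|∇ω|_F ∈ L²`, integrable stretching density, and `|v × ω| ≤ M_⊥|ω|` pointwise: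
`|∫⟪ω, Dv ω⟫| ≤ M_⊥ · √(∫‖ω‖²) · √(∫‖curl ω‖²)`. [folklore] -/
theorem abs_integral_stretching_le_normalAmplitude (hv : ContDiff ℝ 2 v) (hdiv : VectorCalculus.IsDivFree v)
    {M Mn : ℝ} (hM : ∀ x, ‖v x‖ ≤ M) (hMn : ∀ x, ‖cross (v x) (curl v x)‖ ≤ Mn * ‖curl v x‖)
    (iZ : Integrable (fun x => ‖curl v x‖ ^ 2))
    (iA : Integrable (fun x => frobeniusNormSq (fderiv ℝ (curl v) x)))
    (iJ : Integrable (fun x => ⟪curl v x, fderiv ℝ v x (curl v x)⟫)) :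
    |∫ x, ⟪curl v x, fderiv ℝ v x (curl v x)⟫| ≤
      Mn * Real.sqrt (∫ x, ‖curl v x‖ ^ 2) * Real.sqrt (∫ x, ‖curl (curl v) x‖ ^ 2) := by
  rw [integral_stretching_eq_integral_inner_cross hv hdiv hM iZ iA iJ]
  have cω : Continuous (curl v) := continuous_curl (hv.of_le (by norm_num))
  have cc : Continuous (curl (curl v)) := continuous_curl (contDiff_one_curl_of_contDiff_two hv)
  have ic2 : Integrable (fun x => ‖curl (curl v) x‖ ^ 2) := integrable_norm_curl_curl_sq hv iA
  have hMn0 : 0 ≤ Mn ∨ ∀ x, curl v x = 0 := by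
    by_cases h : ∃ x, curl v x ≠ 0
    · obtain ⟨x, hx⟩ := h
      left
      have hpos : 0 < ‖curl v x‖ := norm_pos_iff.2 hx
      nlinarith [hMn x, norm_nonneg (cross (v x) (curl v x))]
    · right; push Not at h; exact h
  -- pointwise `|⟪v, ω × c⟫| ≤ Mn ‖ω‖ ‖c‖`
  have hpt : ∀ x, |⟪v x, cross (curl v x) (curl (curl v) x)⟫| ≤ Mn * (‖curl v x‖ * ‖curl (curl v) x‖) := by
    intro x
    calc |⟪v x, cross (curl v x) (curl (curl v) x)⟫| ≤ ‖curl (curl v) x‖ * ‖cross (v x) (curl v x)‖ :=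
          abs_inner_cross_le_norm_mul_norm_cross _ _ _
      _ ≤ ‖curl (curl v) x‖ * (Mn * ‖curl v x‖) := mul_le_mul_of_nonneg_left (hMn x) (norm_nonneg _)
      _ = Mn * (‖curl v x‖ * ‖curl (curl v) x‖) := by ring
  have iprod : Integrable (fun x => ‖curl v x‖ * ‖curl (curl v) x‖) :=
    (memLp_two_norm_curl hv iZ).integrable_mul (memLp_two_norm_curl_curl hv iA)
  have h1 : |∫ x, ⟪v x, cross (curl v x) (curl (curl v) x)⟫| ≤ Mn * ∫ x, ‖curl v x‖ * ‖curl (curl v) x‖ := by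
    rw [← integral_const_mul]
    refine (abs_integral_le_integral_abs).trans (integral_mono_of_nonneg (Eventually.of_forall fun x =>
      abs_nonneg _) (iprod.const_mul Mn) (Eventually.of_forall hpt))
  have hcs : ∫ x, ‖curl v x‖ * ‖curl (curl v) x‖ ≤
      Real.sqrt (∫ x, ‖curl v x‖ ^ 2) * Real.sqrt (∫ x, ‖curl (curl v) x‖ ^ 2) :=
    integral_mul_le_sqrt_mul_sqrt (μ := volume) (fun x => norm_nonneg _) (fun x => norm_nonneg _)
      cω.norm.aestronglyMeasurable cc.norm.aestronglyMeasurable iZ ic2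
  rcases hMn0 with hMn0 | hzero
  · calc |∫ x, ⟪v x, cross (curl v x) (curl (curl v) x)⟫| ≤ Mn * ∫ x, ‖curl v x‖ * ‖curl (curl v) x‖ := h1
      _ ≤ Mn * (Real.sqrt (∫ x, ‖curl v x‖ ^ 2) * Real.sqrt (∫ x, ‖curl (curl v) x‖ ^ 2)) :=
          mul_le_mul_of_nonneg_left hcs hMn0
      _ = _ := by ring
  · -- `ω ≡ 0`: both sides vanish
    have h0 : (fun x => ⟪v x, cross (curl v x) (curl (curl v) x)⟫) = fun _ => 0 := by
      funext x; rw [hzero x]; simp [cross]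
    have hZ0 : ∫ x, ‖curl v x‖ ^ 2 = 0 := by simp [hzero]
    rw [h0, integral_zero, abs_zero, hZ0, Real.sqrt_zero, mul_zero, zero_mul]

/-! ## Along a flow -/

/-- **The normal-velocity bound along a flow.** For a classical Leray–Hopf rapidly-decaying-datum solution on
`[0,T)`, every `t ∈ [0,T)` and every `M_⊥` with `|u(t,x) × ω(t,x)| ≤ M_⊥ |ω(t,x)|` for all `x`:
`|∫⟪ω(t), Du(t) ω(t)⟫| ≤ M_⊥ · ‖ω(t)‖₂ · ‖∇ω(t)‖₂` (slices are admissible by the Tao cover; `‖curl ω‖₂ = ‖∇ω‖₂`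
for the divergence-free `ω`, `integral_norm_curl_curl_sq_eq`). [folklore] -/
theorem normalAmplitude_along_flow {ν T : ℝ} (hν : 0 < ν) (hT : 0 < T)
    {u : ℝ → EuclideanSpace ℝ (Fin 3) → EuclideanSpace ℝ (Fin 3)}
    {p : ℝ → EuclideanSpace ℝ (Fin 3) → ℝ}
    (hsol : IsClassicalNSSolutionOn (Ico 0 T) ν 0 u p) (hLH : IsLerayHopfOn T ν 0 (u 0) u)
    (hdec : HasRapidSpatialDecay (u 0)) :
    ∀ t ∈ Ico 0 T, ∀ Mn : ℝ, (∀ x, ‖cross (u t x) (curl (u t) x)‖ ≤ Mn * ‖curl (u t) x‖) →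
      |∫ x, ⟪curl (u t) x, fderiv ℝ (u t) x (curl (u t) x)⟫| ≤
        Mn * Real.sqrt (∫ x, ‖curl (u t) x‖ ^ 2) *
          Real.sqrt (∫ x, frobeniusNormSq (fderiv ℝ (curl (u t)) x)) := by
  intro t ht Mn hMn
  have ht' : (t + T) / 2 ∈ Ioo 0 T := ⟨by linarith [ht.1], by linarith [ht.2]⟩
  obtain ⟨q, hsolt, hut, -, -⟩ := stub_taoCover hν hT hsol hLH hdec ht'
  have htI : t ∈ Icc 0 ((t + T) / 2) := ⟨ht.1, by linarith [ht.2]⟩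
  obtain ⟨B₀, -, hB₀⟩ := exists_forall_norm_le_of_hasBoundedSobolevNormsOn hsolt hut
  obtain ⟨iZ, iA, iJ⟩ := slice_integrability hsolt hut htI
  have hv : ContDiff ℝ ∞ (u t) := hsol.contDiff_velocity ht
  have h := abs_integral_stretching_le_normalAmplitude (hv.of_le (by norm_cast)) (hsol.divFree t ht)
    (hB₀ t htI) hMn iZ iA iJ
  rwa [integral_norm_curl_curl_sq_eq (hv.of_le (by norm_cast)) iZ iA] at h

/-! ## The rung and its portrait -/

/-- **THE NORMAL-VELOCITY RUNG (log-mean form).** A classical Leray–Hopf rapidly-decaying-datum solution on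
`[0,T)` which, from some onset `t₁`, admits a normal-velocity majorant `m_⊥` —
`|u(t,x) × ω(t,x)| ≤ m_⊥(t)|ω(t,x)|` for `t ∈ [t₁,T)` — with `m_⊥²` locally interval integrable and
`∫_{t₁}^t m_⊥² ≤ ν(A log((T−t₁)/(T−t)) + B)`, `A < 1`, extends smoothly past `T`. No hypothesis on the full speed.
[folklore] -/
theorem hasSmoothExtensionPast_of_logIntegral_normalAmplitude {ν T t₁ A B : ℝ} (hν : 0 < ν) (hT : 0 < T)
    (hA : A < 1) (ht₁ : t₁ ∈ Ico 0 T)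
    {u : ℝ → EuclideanSpace ℝ (Fin 3) → EuclideanSpace ℝ (Fin 3)}
    {p : ℝ → EuclideanSpace ℝ (Fin 3) → ℝ}
    (hsol : IsClassicalNSSolutionOn (Ico 0 T) ν 0 u p) (hLH : IsLerayHopfOn T ν 0 (u 0) u)
    (hdec : HasRapidSpatialDecay (u 0))
    {m : ℝ → ℝ} (hamp : ∀ t ∈ Ico t₁ T, ∀ x, ‖cross (u t x) (curl (u t) x)‖ ≤ m t * ‖curl (u t) x‖)
    (hii : ∀ t ∈ Ico t₁ T, IntervalIntegrable (fun τ => m τ ^ 2) volume t₁ t)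
    (hint : ∀ t ∈ Ico t₁ T, ∫ τ in t₁..t, m τ ^ 2 ≤ ν * (A * Real.log ((T - t₁) / (T - t)) + B)) :
    HasSmoothExtensionPast ν 0 u T := by
  have hA' : (1 : ℝ) ^ 2 * A < 1 := by simpa using hA
  refine hasSmoothExtensionPast_of_logIntegral_amplitude_of_depletion hν hT hA' ht₁ hsol hLH hdec hii
    (fun t ht => ?_) hint
  rw [one_mul]
  exact normalAmplitude_along_flow hν hT hsol hLH hdec t ⟨ht₁.1.trans ht.1, ht.2⟩ (m t) (hamp t ht)

/-- **The normal-velocity rung, sup form.** If eventually (as `t ↑ T`)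
`√(T−t)·|u(t,x) × ω(t,x)| ≤ C_⊥ √ν |ω(t,x)|` for all `x`, with `0 ≤ C_⊥ < 1`, the classical Leray–Hopf
rapidly-decaying-datum solution extends smoothly past `T` — whatever the full speed does. [folklore] -/
theorem hasSmoothExtensionPast_of_normalVelocityRate {ν T Cn : ℝ} (hν : 0 < ν) (hT : 0 < T) (hCn0 : 0 ≤ Cn)
    (hCn : Cn < 1)
    {u : ℝ → EuclideanSpace ℝ (Fin 3) → EuclideanSpace ℝ (Fin 3)}
    {p : ℝ → EuclideanSpace ℝ (Fin 3) → ℝ}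
    (hsol : IsClassicalNSSolutionOn (Ico 0 T) ν 0 u p) (hLH : IsLerayHopfOn T ν 0 (u 0) u)
    (hdec : HasRapidSpatialDecay (u 0))
    (hrate : ∀ᶠ t in 𝓝[<] T, ∀ x,
      Real.sqrt (T - t) * ‖cross (u t x) (curl (u t) x)‖ ≤ Cn * Real.sqrt ν * ‖curl (u t) x‖) :
    HasSmoothExtensionPast ν 0 u T := by
  obtain ⟨a, haT, hsub⟩ := mem_nhdsLT_iff_exists_Ioo_subset.1 hrate
  set t₁ : ℝ := max a 0 / 2 + T / 2 with ht₁def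
  have hmax : max a 0 < T := max_lt haT hT
  have ht₁ : t₁ ∈ Ico 0 T := by
    refine ⟨?_, ?_⟩
    · have := le_max_right a 0; rw [ht₁def]; linarith
    · rw [ht₁def]; linarith
  have hat₁ : a < t₁ := by have := le_max_left a 0; rw [ht₁def]; linarith
  -- the amplitude `m(τ) = C_⊥ √ν / √(T−τ)`
  set m : ℝ → ℝ := fun τ => Cn * Real.sqrt ν / Real.sqrt (T - τ) with hmdef
  have hm2 : ∀ τ, τ < T → m τ ^ 2 = Cn ^ 2 * ν / (T - τ) := by
    intro τ hτ
    have hTτ : 0 < T - τ := sub_pos.2 hτ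
    rw [hmdef]; simp only
    rw [div_pow, mul_pow, Real.sq_sqrt hν.le, Real.sq_sqrt hTτ.le]
  have hamp : ∀ t ∈ Ico t₁ T, ∀ x, ‖cross (u t x) (curl (u t) x)‖ ≤ m t * ‖curl (u t) x‖ := by
    intro t ht x
    have hTt : 0 < Real.sqrt (T - t) := Real.sqrt_pos.2 (sub_pos.2 ht.2)
    have h := hsub ⟨hat₁.trans_le ht.1, ht.2⟩ x
    rw [hmdef]; simp only
    rw [div_mul_eq_mul_div, le_div_iff₀ hTt]
    linarith
  have hcont : ∀ t ∈ Ico t₁ T, ContinuousOn (fun τ => m τ ^ 2) (uIcc t₁ t) := by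
    intro t ht
    have : ∀ τ ∈ uIcc t₁ t, τ < T := fun τ hτ => by
      rw [uIcc_of_le ht.1] at hτ; exact hτ.2.trans_lt ht.2
    refine ContinuousOn.pow (ContinuousOn.div continuousOn_const
      (Real.continuous_sqrt.comp_continuousOn (continuousOn_const.sub continuousOn_id)) fun τ hτ => ?_) 2
    exact (Real.sqrt_pos.2 (sub_pos.2 (this τ hτ))).ne'
  have hii : ∀ t ∈ Ico t₁ T, IntervalIntegrable (fun τ => m τ ^ 2) volume t₁ t := fun t ht =>
    (hcont t ht).intervalIntegrable
  have hint : ∀ t ∈ Ico t₁ T, ∫ τ in t₁..t, m τ ^ 2 ≤ ν * (Cn ^ 2 * Real.log ((T - t₁) / (T - t)) + 0) := by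
    intro t ht
    have heq : ∫ τ in t₁..t, m τ ^ 2 = ∫ τ in t₁..t, (Cn ^ 2 * ν) / (T - τ) := by
      refine intervalIntegral.integral_congr fun τ hτ => ?_
      rw [uIcc_of_le ht.1] at hτ
      exact hm2 τ (hτ.2.trans_lt ht.2)
    rw [heq, integral_const_div_sub ht.1 ht.2]
    linarith
  have hA : Cn ^ 2 < 1 := by nlinarith
  exact hasSmoothExtensionPast_of_logIntegral_normalAmplitude hν hT hA ht₁ hsol hLH hdec hamp hii hint

/-- **Portrait of a singular time: the normal velocity reaches the self-similar rate.** If the classical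
Leray–Hopf rapidly-decaying-datum solution does NOT extend past `T`, then for every `0 ≤ C_⊥ < 1` it is NOT
eventually true that `√(T−t)·|u(t,x) × ω(t,x)| ≤ C_⊥√ν|ω(t,x)|` for all `x`: the velocity component normal to
the vortex lines exceeds `C_⊥ √(ν/(T−t))` somewhere, at times accumulating at `T`. [folklore] -/
theorem frequently_normalVelocity_gt_of_not_hasSmoothExtensionPast {ν T Cn : ℝ} (hν : 0 < ν) (hT : 0 < T)
    (hCn0 : 0 ≤ Cn) (hCn : Cn < 1)
    {u : ℝ → EuclideanSpace ℝ (Fin 3) → EuclideanSpace ℝ (Fin 3)}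
    {p : ℝ → EuclideanSpace ℝ (Fin 3) → ℝ}
    (hsol : IsClassicalNSSolutionOn (Ico 0 T) ν 0 u p) (hLH : IsLerayHopfOn T ν 0 (u 0) u)
    (hdec : HasRapidSpatialDecay (u 0)) (hsing : ¬ HasSmoothExtensionPast ν 0 u T) :
    ∃ᶠ t in 𝓝[<] T, ∃ x,
      Cn * Real.sqrt ν * ‖curl (u t) x‖ < Real.sqrt (T - t) * ‖cross (u t x) (curl (u t) x)‖ := by
  by_contra h
  have h' : ∀ᶠ t in 𝓝[<] T, ∀ x,
      Real.sqrt (T - t) * ‖cross (u t x) (curl (u t) x)‖ ≤ Cn * Real.sqrt ν * ‖curl (u t) x‖ := by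
    simp only [Filter.not_frequently, not_exists, not_lt] at h
    exact h
  exact hsing (hasSmoothExtensionPast_of_normalVelocityRate hν hT hCn0 hCn hsol hLH hdec h')

end Summit.NavierStokesRegularity.NavierStokesRegularity.Theorems.DepletionLadder

end
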